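import Summits.HodgeConjecture.HodgeConjecture.Theorems.PadicSemiregularLiftHodgeFermatVarietiesPairedOfLargePrimesDichotomy
import HarnessLib

/-!
# Short character-sum configurations, VI bis: even or a full fibre, for ℕ-valued configurations

Crux `HodgeFermatVarieties` (stmt-HodgeConjecture-1334), line `cancel-by-any-claim-lattice`, stub S16-L1
`stub_fibre_of_boundary_nat` (skeleton of lead c4; worker file), boundary prime `p₀`.

* `even_or_fibre_of_boundary_nat` — the dichotomy `PairedNull.even_or_fibre_of_boundary` of part VI
  (`…PairedOfLargePrimesDichotomy`) with the `{0,1}`-valuedness of the configuration `T : ℤ/(p₀ n) → ℂ`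
  relaxed to ℕ-valuedness: `T` supported on units, annihilated by every odd primitive character mod
  `p₀ n`, with room `#supp T + 1 < p'` at the primes `p'` of `n`, is EITHER even, OR its support
  contains a full fibre `{crt⁻¹(y, b) : y ∈ (ℤ/p₀)ˣ}` over a unit `b` mod `n`. The proof is that of
  part VI up to the fibre constancy (`piece_annihilated`, `fibre_const_of_piece` of part V): a point
  `z₀` with `T(-z₀) ≠ T(z₀)` makes `y ↦ Tp(crt⁻¹(y, b₀)) - Tp(-crt⁻¹(y, b₀))` (`Tp` the piece of `T`
  around `z₀`) the NON-ZERO INTEGER constant `T z₀ - T(-z₀)`; if it is positive the fibre over `b₀`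
  lies in the support of `Tp ≤ T`, if negative the fibre over `-b₀` does (`crt⁻¹(y, -b₀) = -crt⁻¹(-y, b₀)`).
* `stub_fibre_of_boundary_nat` — the registered (fully quantified) signature of the stub.

Everything here is proved; no named facts, no new definitions. The lead's stub S16-L2 applies this at
the level `M = 5 n` of a non-paired Hodge sextuple.

References: [Aoki1983] N. Aoki, Math. Ann. 266 (1983) 23–54, Prop. 6.4 and §9.
-/

-- the summit and the problem are both called `HodgeConjecture` (directory layout), as in every sibling file
set_option linter.dupNamespace false

noncomputable section

open Finset
open Literature.AlgebraicGeometry.HodgeTheory Literature.AlgebraicGeometry.HodgeTheory.FermatCharacter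

namespace Summit.HodgeConjecture.HodgeConjecture.Theorems.CancelByAnyClaimLattice

namespace PairedNull

section DichotomyNat

variable {p₀ n : ℕ} [NeZero p₀] [NeZero n]

/-- `πq[p']` — reduction from level `p₀ · n` to the prime power `p' ^ v_{p'}(n)` of `n`. Local notation. -/
local notation3 (prettyPrint := false) "πq[" p' "]" =>
  ZMod.castHom ((Nat.ordProj_dvd n p').trans (dvd_mul_left n p₀)) (ZMod (p' ^ n.factorization p'))

/-- `Reg[P, x, z]` — `z ≡ ±x` modulo `p' ^ v_{p'}(n)` for every `p' ∈ P`. Local notation. -/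
local notation3 (prettyPrint := false) "Reg[" P ", " x ", " z "]" =>
  ∀ p' ∈ (P : Finset ℕ), πq[p'] z = πq[p'] x ∨ πq[p'] z = -(πq[p'] x)

/-- **Even, or a full fibre (ℕ-valued configurations).** Let `p₀ ≥ 5` be a prime not dividing `n`, all
prime factors of `n` `≥ 5`, and let `T : ℤ/(p₀ n) → ℂ` take values in `ℕ`, vanish off the units, be
annihilated by every odd primitive character mod `p₀ n`, and have `#supp T + 1 < p'` for every prime
`p' ∣ n`. Then either `T(-z) = T(z)` for all `z`, or for some unit `b` mod `n` the whole fibre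
`{crt⁻¹(y, b) : y a unit mod p₀}` lies in the support of `T`. [cite: Aoki1983, Prop. 6.4 and §9] -/
theorem even_or_fibre_of_boundary_nat (hp₀ : p₀.Prime) (hp₀5 : 5 ≤ p₀) (hp₀n : ¬ p₀ ∣ n)
    (hn5 : ∀ p' ∈ n.primeFactors, 5 ≤ p') (hc : p₀.Coprime n)
    (T : ZMod (p₀ * n) → ℂ) (hN : ∀ z, ∃ k : ℕ, T z = k) (hTu : ∀ z, ¬ IsUnit z → T z = 0)
    (hT : ∀ χ : DirichletCharacter ℂ (p₀ * n), χ.Odd → χ.IsPrimitive → ∑ z : ZMod (p₀ * n), T z * χ z = 0)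
    (hroom : ∀ p' ∈ n.primeFactors, #(univ.filter fun z : ZMod (p₀ * n) ↦ T z ≠ 0) + 1 < p') :
    (∀ z, T (-z) = T z) ∨
      ∃ b : ZMod n, IsUnit b ∧ ∀ y : (ZMod p₀)ˣ, T ((ZMod.chineseRemainder hc).symm ((y : ZMod p₀), b)) ≠ 0 := by
  classical
  by_cases hev : ∀ z, T (-z) = T z
  · exact Or.inl hev
  right
  push Not at hev
  obtain ⟨z₀, hz₀⟩ := hev
  have hz₀u : IsUnit z₀ := by
    by_contra hnu
    exact hz₀ (by rw [hTu z₀ hnu, hTu (-z₀) (fun h ↦ hnu (by simpa using h.neg))])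
  -- the piece of `T` around `z₀`
  set Tp : ZMod (p₀ * n) → ℂ := fun z ↦ if Reg[n.primeFactors, z₀, z] then T z else 0 with hTp
  have hTpann := piece_annihilated hp₀ hp₀5 hp₀n hn5 T hTu hT hroom hz₀u n.primeFactors (subset_refl _)
  have hTpsupp : ∀ z, Tp z ≠ 0 → IsUnit z ∧ Reg[n.primeFactors, z₀, z] := by
    intro z hz
    by_cases hreg : Reg[n.primeFactors, z₀, z]
    · refine ⟨?_, hreg⟩
      by_contra hnu
      exact hz (by simp only [hTp, if_pos hreg, hTu z hnu])
    · exact absurd (by simp only [hTp, if_neg hreg]) hz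
  have hTpval : ∀ z, Tp z ≠ 0 → Tp z = T z := by
    intro z hz
    by_cases hreg : Reg[n.primeFactors, z₀, z]
    · simp only [hTp, if_pos hreg]
    · exact absurd (by simp only [hTp, if_neg hreg]) hz
  have hTpz₀ : Tp z₀ = T z₀ := by
    simp only [hTp, if_pos (fun p' _ ↦ Or.inl rfl)]
  have hTpnz₀ : Tp (-z₀) = T (-z₀) := by
    simp only [hTp]
    rw [if_pos]
    intro p' _
    right
    rw [map_neg]
  -- coordinates of `z₀`
  set y₀u : (ZMod p₀)ˣ := (hz₀u.map (ZMod.castHom (dvd_mul_right p₀ n) (ZMod p₀))).unit with hy₀u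
  set b₀ : ZMod n := ZMod.castHom (dvd_mul_left n p₀) (ZMod n) z₀
  have hb₀u : IsUnit b₀ := hz₀u.map _
  have hz₀eq : (ZMod.chineseRemainder hc).symm ((y₀u : ZMod p₀), b₀) = z₀ := by
    rw [hy₀u, IsUnit.unit_spec]; exact crt_symm_castHom hc z₀
  -- fibre constancy: `D y = D 1 = D y₀ = T z₀ - T(-z₀)`
  have hconst := fun y ↦ fibre_const_of_piece hp₀ hc hn5 Tp hTpann hz₀u hTpsupp b₀ y
  have hDy₀ : Tp ((ZMod.chineseRemainder hc).symm (1, b₀)) - Tp (-(ZMod.chineseRemainder hc).symm (1, b₀)) =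
      T z₀ - T (-z₀) := by
    rw [← hconst y₀u, hz₀eq, hTpz₀, hTpnz₀]
  -- values: `Tp z ∈ ℕ` (`Tp z` is `T z` or `0`)
  have hTpN : ∀ z, ∃ k : ℕ, Tp z = k := by
    intro z
    by_cases hz : Tp z = 0
    · exact ⟨0, by rw [hz, Nat.cast_zero]⟩
    · rw [hTpval z hz]; exact hN z
  obtain ⟨k₀, hk₀⟩ := hN z₀
  obtain ⟨k₁, hk₁⟩ := hN (-z₀)
  have hk : k₀ ≠ k₁ := by
    rintro rfl
    exact hz₀ (by rw [hk₀, hk₁])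
  -- the two cases `T z₀ - T(-z₀) = k₀ - k₁ < 0` and `> 0`
  rcases Nat.lt_or_gt_of_ne hk with hlt | hlt
  · -- `T z₀ < T(-z₀)`: the fibre over `-b₀` lies in the support
    refine ⟨-b₀, hb₀u.neg, fun y ↦ ?_⟩
    have hD : Tp ((ZMod.chineseRemainder hc).symm ((-y : (ZMod p₀)ˣ), b₀)) -
        Tp (-(ZMod.chineseRemainder hc).symm ((-y : (ZMod p₀)ˣ), b₀)) = k₀ - k₁ := by
      rw [hconst (-y), hDy₀, hk₀, hk₁]
    have hneg : -(ZMod.chineseRemainder hc).symm (((-y : (ZMod p₀)ˣ) : ZMod p₀), b₀) =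
        (ZMod.chineseRemainder hc).symm ((y : ZMod p₀), -b₀) := by
      rw [← crt_symm_neg, Units.val_neg, neg_neg]
    rw [hneg] at hD
    obtain ⟨a, ha⟩ := hTpN ((ZMod.chineseRemainder hc).symm (((-y : (ZMod p₀)ˣ) : ZMod p₀), b₀))
    obtain ⟨c, hc'⟩ := hTpN ((ZMod.chineseRemainder hc).symm ((y : ZMod p₀), -b₀))
    have hsum : a + k₁ = c + k₀ := by
      have h : (a : ℂ) + k₁ = c + k₀ := by
        rw [ha, hc'] at hD
        linear_combination hD
      exact_mod_cast h
    have hTpne : Tp ((ZMod.chineseRemainder hc).symm ((y : ZMod p₀), -b₀)) ≠ 0 := by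
      rw [hc']
      exact_mod_cast show c ≠ 0 by omega
    rwa [← hTpval _ hTpne]
  · -- `T(-z₀) < T z₀`: the fibre over `b₀` lies in the support
    refine ⟨b₀, hb₀u, fun y ↦ ?_⟩
    have hD : Tp ((ZMod.chineseRemainder hc).symm ((y : ZMod p₀), b₀)) -
        Tp (-(ZMod.chineseRemainder hc).symm ((y : ZMod p₀), b₀)) = k₀ - k₁ := by
      rw [hconst y, hDy₀, hk₀, hk₁]
    obtain ⟨a, ha⟩ := hTpN ((ZMod.chineseRemainder hc).symm ((y : ZMod p₀), b₀))
    obtain ⟨c, hc'⟩ := hTpN (-(ZMod.chineseRemainder hc).symm ((y : ZMod p₀), b₀))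
    have hsum : a + k₁ = c + k₀ := by
      have h : (a : ℂ) + k₁ = c + k₀ := by
        rw [ha, hc'] at hD
        linear_combination hD
      exact_mod_cast h
    have hTpne : Tp ((ZMod.chineseRemainder hc).symm ((y : ZMod p₀), b₀)) ≠ 0 := by
      rw [ha]
      exact_mod_cast show a ≠ 0 by omega
    rwa [← hTpval _ hTpne]

end DichotomyNat

/-- **S16-L1 `stub_fibre_of_boundary_nat` — even, or a full fibre, for ℕ-valued configurations**
(registered signature of the stub; `even_or_fibre_of_boundary_nat` fully quantified). Let `p₀ ≥ 5` be a
prime not dividing `n`, all prime factors of `n` `≥ 5`, and `T : ℤ/(p₀ n) → ℂ` ℕ-valued, supported on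
units, annihilated by every odd primitive character mod `p₀ n`, with `#supp T + 1 < p'` for every prime
`p' ∣ n`. Then `T` is even, or some full fibre `{crt⁻¹(y, b) : y ∈ (ℤ/p₀)ˣ}` (`b` a unit mod `n`)
lies in its support. [cite: Aoki1983, Prop. 6.4 and §9] -/
theorem stub_fibre_of_boundary_nat :
    ∀ (p₀ n : ℕ) [NeZero p₀] [NeZero n], p₀.Prime → 5 ≤ p₀ → ¬ p₀ ∣ n →
      (∀ p' ∈ n.primeFactors, 5 ≤ p') → ∀ (hc : p₀.Coprime n) (T : ZMod (p₀ * n) → ℂ),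
      (∀ z, ∃ k : ℕ, T z = k) → (∀ z, ¬ IsUnit z → T z = 0) →
      (∀ χ : DirichletCharacter ℂ (p₀ * n), χ.Odd → χ.IsPrimitive → ∑ z : ZMod (p₀ * n), T z * χ z = 0) →
      (∀ p' ∈ n.primeFactors, #(univ.filter fun z : ZMod (p₀ * n) ↦ T z ≠ 0) + 1 < p') →
      (∀ z, T (-z) = T z) ∨
        ∃ b : ZMod n, IsUnit b ∧ ∀ y : (ZMod p₀)ˣ, T ((ZMod.chineseRemainder hc).symm ((y : ZMod p₀), b)) ≠ 0 := by
  intro p₀ n _ _ hp₀ hp₀5 hp₀n hn5 hc T hN hTu hT hroom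
  exact even_or_fibre_of_boundary_nat hp₀ hp₀5 hp₀n hn5 hc T hN hTu hT hroom

end PairedNull

end Summit.HodgeConjecture.HodgeConjecture.Theorems.CancelByAnyClaimLattice
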